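import Mathlib
import Literature.Computability.AlgebraicComplexity.MignonRessayreBound
import Literature.Computability.AlgebraicComplexity.StandardFamiliesProofs
import Literature.LinearAlgebra.Matrix.Berkowitz
import Summits.ValiantsHypothesis.ValiantsHypothesis.Theorems.DetQPDetqpSuperquadraticStubVertexGauge

/-!
# Crux `DetQP.DetqpSuperquadratic` (stmt-ValiantsHypothesis-0318), line `linear-homogenisation-transfer` —
stub `stub_krylovMRFloor` (S2½): the Mignon–Ressayre floor INSIDE the Krylov model

The line reduces the crux `dc(per_n) ≥ n^(2+ε)` to a width statement about KRYLOV NORMAL FORMS of the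
permanent: homogeneous linear `ρ, γ ∈ (S¹)^w`, `L ∈ M_w(S¹)` (`S = ℂ[x_ij]`) with
(A3) `ρᵀ L^(n−2) γ = per_n`, (A2) `ρᵀ Lʲ γ = 0` for `j < n − 2`, (A4) `per_n ∣ ρᵀ Lʲ γ` for all `j`
(every determinantal expression of size `w + 1` yields one: stubs S1a, S1b; Chatterjee–Kumar–Volk 2024
Thm 13).  This file proves that the quadratic floor of Mignon–Ressayre holds in that model with no loss:

  `stub_krylovMRFloor`:  every Krylov normal form of `per_n` (`n ≥ 3`) of width `w` has `n² ≤ 2w + 4`.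

Proof (new; the cards of the line recorded `w ≥ n` as the model's frontier and the transfer by
unrolling, `dc ≤ (n−1)w + 1`, gives only `w ≳ n/2`).
1. *Transfer numerator* (`KrylovFloor.dotProduct_adjugate_smul_one_sub_mulVec`, from the tree's
   Faddeev–LeVerrier expansion `adjugate_charmatrix`): for a scalar `z`,
   `ρᵀ adj(z·1 − L) γ = ∑_k ∑_{l<k} χ_k z^l h_{k−1−l}` (`χ_L = ∑ χ_k X^k`, `h_j = ρᵀ Lʲ γ`).
2. By (A2)/(A4), `h_j = per_n · u_j` with `u_j = 0` (`j < n−2`), `u_{n−2} = 1`; hence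
   `ρᵀ adj(z·1 − L) γ = per_n · q_z`, and `z ↦ q_z(x₀)` is a MONIC polynomial of degree `w − n + 1`
   for every point `x₀` (Cayley–Hamilton first gives `w ≥ n − 1`, `KrylovFloor.width_ge_of_krylov`).
3. `ρᵀ adj(z·1 − L) γ = det [[0, −ρᵀ], [γ, z·1 − L]]` — an AFFINE determinantal expression of
   `per_n · q_z` of size `w + 1` (bordered determinant, `VertexGauge.det_bordered` of the S1a file).
4. At the Mignon–Ressayre point `x₀` of `{per_n = 0}` (tree: `eval_mrPoint_perPoly`,
   `hess0_transl_mrPoint_perPoly`, `rank_mrHess`) choose `z ≠ 0` off the roots of `q_·(x₀)`; the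
   Hessian of `per_n · q_z` at `x₀` is `q_z(x₀) · H_per(x₀)` (rank `n²`) plus `∇per ∇qᵀ + ∇q ∇perᵀ`
   (rank `≤ 2`), and has rank `≤ 2(w + 1)` by the tree's `rank_hess0_det_le`.  Hence `n² − 2 ≤ 2(w+1)`.
Consequence for the line: the registered transfer stub S3 now carries `n² ≤ 2w + 4` as a free
hypothesis and asks only for the super-quadratic EXCESS inside the model.
-/

noncomputable section

-- `Summit.ValiantsHypothesis.ValiantsHypothesis.…` is the tree's mandated single-conjunct layout (Sub = Summit).
set_option linter.dupNamespace false

namespace Summit.ValiantsHypothesis.ValiantsHypothesis.Theorems.DetQPDetqpSuperquadratic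

open MvPolynomial Matrix
open Literature.Computability.AlgebraicComplexity

namespace KrylovFloor

section TransferNumerator

variable {S : Type*} [CommRing S] {w : ℕ}

/-- Entries of `adj(c·1 − L)` by Faddeev–LeVerrier: evaluate `adjugate_charmatrix` at `X = c`.
`adj(c·1 − L) i j = ∑_k ∑_{l<k} χ_k c^l (L^{k-1-l}) i j` with `χ_L = ∑ χ_k X^k`. [folklore] -/
theorem adjugate_smul_one_sub_apply (L : Matrix (Fin w) (Fin w) S) (c : S) (i j : Fin w) :
    (c • (1 : Matrix (Fin w) (Fin w) S) - L).adjugate i j =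
      ∑ k ∈ Finset.range (w + 1), ∑ l ∈ Finset.range k,
        L.charpoly.coeff k * c ^ l * (L ^ (k - (l + 1))) i j := by
  have hmap : (Polynomial.evalRingHom c).mapMatrix (charmatrix L) = c • (1 : Matrix _ _ S) - L := by
    ext a b
    rw [RingHom.mapMatrix_apply, Matrix.map_apply, Matrix.sub_apply, Matrix.smul_apply,
      Matrix.one_apply]
    by_cases hab : a = b
    · subst hab
      simp [charmatrix_apply_eq]
    · simp [hab]
  have h2 : (c • (1 : Matrix (Fin w) (Fin w) S) - L).adjugate =
      (Polynomial.evalRingHom c).mapMatrix ((charmatrix L).adjugate) := by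
    rw [RingHom.map_adjugate, hmap]
  rw [h2, Literature.LinearAlgebra.Matrix.adjugate_charmatrix L, Fintype.card_fin, RingHom.mapMatrix_apply,
    Matrix.map_apply, Matrix.sum_apply, Polynomial.coe_evalRingHom, Polynomial.eval_finsetSum]
  refine Finset.sum_congr rfl fun k _ => ?_
  rw [Matrix.smul_apply, Matrix.sum_apply, smul_eq_mul, Polynomial.eval_mul, Polynomial.eval_C,
    Polynomial.eval_finsetSum, Finset.mul_sum]
  refine Finset.sum_congr rfl fun l _ => ?_
  rw [Matrix.smul_apply, Matrix.map_apply, smul_eq_mul, Polynomial.eval_mul, Polynomial.eval_pow,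
    Polynomial.eval_X, Polynomial.eval_C]
  ring

/-- Matrix form of `adjugate_smul_one_sub_apply`. [folklore] -/
theorem adjugate_smul_one_sub (L : Matrix (Fin w) (Fin w) S) (c : S) :
    (c • (1 : Matrix (Fin w) (Fin w) S) - L).adjugate =
      ∑ k ∈ Finset.range (w + 1), ∑ l ∈ Finset.range k,
        (L.charpoly.coeff k * c ^ l) • L ^ (k - (l + 1)) := by
  ext i j
  rw [adjugate_smul_one_sub_apply]
  simp only [Matrix.sum_apply, Matrix.smul_apply, smul_eq_mul]

/-- **Transfer numerator.**  `ρᵀ adj(c·1 − L) γ = ∑_k ∑_{l<k} χ_k c^l h_{k-1-l}` with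
`h_j = ρᵀ L^j γ` the Markov parameters. [folklore] -/
theorem dotProduct_adjugate_smul_one_sub_mulVec (ρ γ : Fin w → S) (L : Matrix (Fin w) (Fin w) S)
    (c : S) :
    ρ ⬝ᵥ ((c • (1 : Matrix (Fin w) (Fin w) S) - L).adjugate *ᵥ γ) =
      ∑ k ∈ Finset.range (w + 1), ∑ l ∈ Finset.range k,
        L.charpoly.coeff k * c ^ l * (ρ ⬝ᵥ (L ^ (k - (l + 1)) *ᵥ γ)) := by
  rw [adjugate_smul_one_sub, Matrix.sum_mulVec, dotProduct_sum]
  refine Finset.sum_congr rfl fun k _ => ?_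
  rw [Matrix.sum_mulVec, dotProduct_sum]
  refine Finset.sum_congr rfl fun l _ => ?_
  rw [Matrix.smul_mulVec, dotProduct_smul, smul_eq_mul]

end TransferNumerator

section Floor

variable {m w : ℕ}

/-- Two-term subadditivity of the rank (from the tree's `rank_sum_le`). [folklore] -/
theorem rank_add_le_add {σ : Type*} [Fintype σ] (A B : Matrix σ σ ℂ) :
    (A + B).rank ≤ A.rank + B.rank := by
  have h := rank_sum_le (Finset.univ : Finset (Fin 2)) ![A, B]
  rw [Fin.sum_univ_two, Fin.sum_univ_two] at h
  simpa using h

/-- If `n² ≤ 2·dc` is to be read inside the Krylov model one needs: a symmetric matrix `H` of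
rank `r` perturbed by `a bᵀ + b aᵀ` keeps rank `≥ r − 2`. [folklore] -/
theorem rank_ge_of_add_vecMulVec {σ : Type*} [Fintype σ] (H : Matrix σ σ ℂ) (a b : σ → ℂ) :
    H.rank ≤ (H + (vecMulVec a b + vecMulVec b a)).rank + 2 := by
  have h1 : H = (H + (vecMulVec a b + vecMulVec b a)) + (-1 : ℂ) • (vecMulVec a b + vecMulVec b a) := by
    rw [neg_one_smul, add_neg_cancel_right]
  have h2 := rank_add_le_add (H + (vecMulVec a b + vecMulVec b a))
    ((-1 : ℂ) • (vecMulVec a b + vecMulVec b a))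
  rw [← h1, rank_smul_eq (by norm_num : (-1 : ℂ) ≠ 0)] at h2
  exact h2.trans (Nat.add_le_add_left (rank_vecMulVec_add_vecMulVec_le a b b a) _)

/-- **Cayley–Hamilton forces `w + 1 ≥ n`**: a Krylov presentation `ρᵀ L^(n−2) γ = f ≠ 0` with
`ρᵀ Lʲ γ = 0` for `j < n − 2` has width `w ≥ n − 1` (else `L^(n−2)` is a combination of lower
powers).  Here `n = m + 3`. [folklore] -/
theorem width_ge_of_krylov {S : Type*} [CommRing S] [Nontrivial S]
    (ρ γ : Fin w → S) (L : Matrix (Fin w) (Fin w) S) {f : S} (hf : f ≠ 0)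
    (hA3 : ρ ⬝ᵥ (L ^ (m + 1) *ᵥ γ) = f) (hA2 : ∀ j : ℕ, j < m + 1 → ρ ⬝ᵥ (L ^ j *ᵥ γ) = 0) :
    m + 2 ≤ w := by
  by_contra hlt
  push Not at hlt
  have hCH := Matrix.aeval_self_charpoly L
  rw [Polynomial.aeval_eq_sum_range, Matrix.charpoly_natDegree_eq_dim, Fintype.card_fin] at hCH
  have h0 : ρ ⬝ᵥ ((L ^ (m + 1 - w) * ∑ k ∈ Finset.range (w + 1), L.charpoly.coeff k • L ^ k) *ᵥ γ)
      = 0 := by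
    rw [hCH, Matrix.mul_zero, Matrix.zero_mulVec, dotProduct_zero]
  rw [Finset.mul_sum, Matrix.sum_mulVec, dotProduct_sum, Finset.sum_range_succ,
    Finset.sum_eq_zero, zero_add, Matrix.mul_smul, ← pow_add,
    show m + 1 - w + w = m + 1 by omega, Matrix.smul_mulVec, dotProduct_smul, hA3] at h0
  · have hmon : L.charpoly.coeff w = 1 := by
      have h := L.charpoly_monic.coeff_natDegree
      rwa [Matrix.charpoly_natDegree_eq_dim, Fintype.card_fin] at h
    rw [hmon, one_smul] at h0
    exact hf h0
  · intro k hk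
    rw [Matrix.mul_smul, ← pow_add, Matrix.smul_mulVec, dotProduct_smul,
      hA2 _ (by have := Finset.mem_range.1 hk; omega), smul_zero]

/-- Entries of `c·1 − L` are affine when the entries of `L` are linear forms. [folklore] -/
theorem totalDegree_smul_one_sub_le {σ : Type*} (L : Matrix (Fin w) (Fin w) (MvPolynomial σ ℂ))
    (hL : ∀ i j, (L i j).IsHomogeneous 1) (c : ℂ) (i j : Fin w) :
    (((C c : MvPolynomial σ ℂ) • (1 : Matrix (Fin w) (Fin w) (MvPolynomial σ ℂ)) - L) i j).totalDegree ≤ 1 := by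
  rw [Matrix.sub_apply, Matrix.smul_apply, Matrix.one_apply]
  refine (totalDegree_sub _ _).trans (max_le ?_ (hL i j).totalDegree_le)
  split_ifs
  · rw [smul_eq_mul, mul_one, totalDegree_C]; exact Nat.zero_le _
  · rw [smul_zero, totalDegree_zero]; exact Nat.zero_le _

/-- `det (c·1 − L)` has constant coefficient `c^w` when `L` has linear entries. [folklore] -/
theorem constantCoeff_det_smul_one_sub {σ : Type*} (L : Matrix (Fin w) (Fin w) (MvPolynomial σ ℂ))
    (hL : ∀ i j, (L i j).IsHomogeneous 1) (c : ℂ) :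
    constantCoeff (((C c : MvPolynomial σ ℂ) • (1 : Matrix (Fin w) (Fin w) (MvPolynomial σ ℂ)) - L).det) = c ^ w := by
  rw [RingHom.map_det]
  have : (RingHom.mapMatrix constantCoeff)
      ((C c : MvPolynomial σ ℂ) • (1 : Matrix (Fin w) (Fin w) (MvPolynomial σ ℂ)) - L)
      = c • (1 : Matrix (Fin w) (Fin w) ℂ) := by
    ext i j
    rw [RingHom.mapMatrix_apply, Matrix.map_apply, Matrix.sub_apply, map_sub, Matrix.smul_apply,
      Matrix.smul_apply, Matrix.one_apply, Matrix.one_apply]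
    have h0 : constantCoeff (L i j) = 0 := by
      rw [constantCoeff_eq]
      exact (hL i j).coeff_eq_zero (by simp)
    rw [h0, sub_zero]
    split_ifs <;> simp
  rw [this, Matrix.det_smul, Matrix.det_one, mul_one, Fintype.card_fin]

/-- **The Mignon–Ressayre floor inside the Krylov model** (core form, `n = m + 3`).  A Krylov
presentation of `per_n` of width `w` — affine `ρ, γ`, linear `L`, (A3) `ρᵀL^(n−2)γ = per_n`,
(A2) `ρᵀLʲγ = 0` for `j < n−2`, (A4) `per_n ∣ ρᵀLʲγ` for all `j` — has `n² ≤ 2(w + 1) + 2`.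
Proof: by Faddeev–LeVerrier and (A2)/(A4) the transfer numerator `ρᵀ adj(z·1 − L) γ` equals
`per_n · q_z` with `q_z(x) = z^(w−n+1) + …` MONIC in the scalar `z`; it is the determinant of the
affine bordered matrix `[[0, −ρᵀ],[γ, z·1 − L]]` of size `w + 1`; at the Mignon–Ressayre point `x₀`
of `{per_n = 0}` choose `z` with `q_z(x₀) ≠ 0`; then the Hessian of `per_n · q_z` at `x₀` is
`q_z(x₀) · H_per(x₀)` (rank `n²`) plus a matrix of rank `≤ 2`, while `rank ≤ 2(w+1)` for any
determinant of affine forms vanishing at the point (`rank_hess0_det_le`). [folklore] -/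
theorem krylov_floor_core
    (ρ γ : Fin w → MvPolynomial (Fin (m + 3) × Fin (m + 3)) ℂ)
    (L : Matrix (Fin w) (Fin w) (MvPolynomial (Fin (m + 3) × Fin (m + 3)) ℂ))
    (hρ : ∀ i, (ρ i).totalDegree ≤ 1) (hγ : ∀ i, (γ i).totalDegree ≤ 1)
    (hL : ∀ i j, (L i j).IsHomogeneous 1)
    (hA3 : ρ ⬝ᵥ (L ^ (m + 1) *ᵥ γ) = perPoly (Fin (m + 3)) ℂ)
    (hA2 : ∀ j : ℕ, j < m + 1 → ρ ⬝ᵥ (L ^ j *ᵥ γ) = 0)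
    (hA4 : ∀ j : ℕ, perPoly (Fin (m + 3)) ℂ ∣ ρ ⬝ᵥ (L ^ j *ᵥ γ)) :
    (m + 3) ^ 2 ≤ 2 * (w + 1) + 2 := by
  classical
  set per := perPoly (Fin (m + 3)) ℂ with hper_def
  have hper0 : per ≠ 0 := perPoly_ne_zero _ _
  -- the quotients `u j = h_j / per`
  have hA4' : ∀ j : ℕ, ∃ c, ρ ⬝ᵥ (L ^ j *ᵥ γ) = per * c := fun j => hA4 j
  choose u hu using hA4'
  have hu_lt : ∀ j : ℕ, j < m + 1 → u j = 0 := by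
    intro j hj
    have h := hu j
    rw [hA2 j hj, eq_comm, mul_eq_zero] at h
    exact h.resolve_left hper0
  have hu_eq : u (m + 1) = 1 := by
    have h := hu (m + 1)
    rw [hA3] at h
    conv_lhs at h => rw [← mul_one per]
    exact (mul_left_cancel₀ hper0 h).symm
  -- the width is at least `n - 1`
  have hw : m + 2 ≤ w := width_ge_of_krylov ρ γ L hper0 hA3 hA2
  -- the Mignon–Ressayre point and the polynomial `z ↦ q_z(x₀)`
  set x₀ : Fin (m + 3) × Fin (m + 3) → ℂ := mrPoint ℂ m with hx₀
  set a : ℕ → ℕ → ℂ := fun k l =>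
    eval x₀ (L.charpoly.coeff k) * eval x₀ (u (k - (l + 1))) with ha
  set P : Polynomial ℂ := ∑ k ∈ Finset.range (w + 1), ∑ l ∈ Finset.range k,
    Polynomial.C (a k l) * Polynomial.X ^ l with hP
  have hmon : L.charpoly.coeff w = 1 := by
    have h := L.charpoly_monic.coeff_natDegree
    rwa [Matrix.charpoly_natDegree_eq_dim, Fintype.card_fin] at h
  have hPcoeff : P.coeff (w - (m + 2)) = 1 := by
    rw [hP, Polynomial.finsetSum_coeff]
    simp only [Polynomial.finsetSum_coeff, Polynomial.coeff_C_mul_X_pow]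
    rw [Finset.sum_eq_single_of_mem w (Finset.mem_range.2 (Nat.lt_succ_self w))]
    · rw [Finset.sum_ite_eq, if_pos (Finset.mem_range.2 (by omega)), ha]
      simp only
      rw [hmon, show w - (w - (m + 2) + 1) = m + 1 by omega, hu_eq]
      simp
    · intro k hk hkw
      rw [Finset.sum_ite_eq]
      split_ifs with hl
      · rw [ha]
        simp only
        have hk' := Finset.mem_range.1 hk
        have hl' := Finset.mem_range.1 hl
        rw [hu_lt (k - (w - (m + 2) + 1)) (by omega), map_zero, mul_zero]
      · rfl
  have hP0 : P ≠ 0 := by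
    intro h
    rw [h, Polynomial.coeff_zero] at hPcoeff
    exact zero_ne_one hPcoeff
  obtain ⟨z₀, hz₀⟩ := Infinite.exists_notMem_finset (P.roots.toFinset ∪ {0})
  rw [Finset.mem_union, Finset.mem_singleton, not_or, Multiset.mem_toFinset,
    Polynomial.mem_roots hP0] at hz₀
  obtain ⟨hPz, hz0⟩ := hz₀
  -- the transfer numerator at `z₀` and its factorisation `F = per * q`
  set D : Matrix (Fin w) (Fin w) (MvPolynomial (Fin (m + 3) × Fin (m + 3)) ℂ) :=
    (C z₀ : MvPolynomial (Fin (m + 3) × Fin (m + 3)) ℂ) •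
      (1 : Matrix (Fin w) (Fin w) (MvPolynomial (Fin (m + 3) × Fin (m + 3)) ℂ)) - L with hD
  set F := ρ ⬝ᵥ (D.adjugate *ᵥ γ) with hF
  set q : MvPolynomial (Fin (m + 3) × Fin (m + 3)) ℂ :=
    ∑ k ∈ Finset.range (w + 1), ∑ l ∈ Finset.range k,
      L.charpoly.coeff k * C z₀ ^ l * u (k - (l + 1)) with hq
  have hFq : F = per * q := by
    rw [hF, hD, dotProduct_adjugate_smul_one_sub_mulVec, hq, Finset.mul_sum]
    refine Finset.sum_congr rfl fun k _ => ?_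
    rw [Finset.mul_sum]
    refine Finset.sum_congr rfl fun l _ => ?_
    rw [hu]
    ring
  have hqx : eval x₀ q = P.eval z₀ := by
    rw [hq, hP, map_sum, Polynomial.eval_finsetSum]
    refine Finset.sum_congr rfl fun k _ => ?_
    rw [map_sum, Polynomial.eval_finsetSum]
    refine Finset.sum_congr rfl fun l _ => ?_
    rw [map_mul, map_mul, map_pow, eval_C, Polynomial.eval_mul, Polynomial.eval_C,
      Polynomial.eval_pow, Polynomial.eval_X, ha]
    ring
  -- `F` is the determinant of an affine matrix of size `w + 1`
  have hDdet : D.det ≠ 0 := by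
    intro h0
    have := constantCoeff_det_smul_one_sub L hL z₀
    rw [← hD, h0, map_zero] at this
    exact hz0 (pow_eq_zero_iff' |>.mp this.symm).1
  set B : Matrix (Unit ⊕ Fin w) (Unit ⊕ Fin w) (MvPolynomial (Fin (m + 3) × Fin (m + 3)) ℂ) :=
    fromBlocks (of fun (_ _ : Unit) => 0) (replicateRow Unit (-ρ)) (replicateCol Unit γ) D with hB
  have hBdet : B.det = F := by
    rw [hB, VertexGauge.det_bordered 0 (-ρ) γ D hDdet, zero_mul, zero_sub, neg_dotProduct,
      neg_neg]
  have hBaff : ∀ i j, (B i j).totalDegree ≤ 1 := by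
    rintro (i | i) (j | j)
    · simp [hB]
    · simp only [hB, fromBlocks_apply₁₂, replicateRow_apply, Pi.neg_apply, totalDegree_neg]
      exact hρ j
    · simp only [hB, fromBlocks_apply₂₁, replicateCol_apply]
      exact hγ i
    · simp only [hB, fromBlocks_apply₂₂]
      exact totalDegree_smul_one_sub_le L hL z₀ i j
  have hcard : Fintype.card (Unit ⊕ Fin w) = w + 1 := by
    rw [Fintype.card_sum, Fintype.card_unit, Fintype.card_fin, add_comm]
  set e : Unit ⊕ Fin w ≃ Fin (w + 1) := Fintype.equivFinOfCardEq hcard with he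
  set A : Matrix (Fin (w + 1)) (Fin (w + 1)) (MvPolynomial (Fin (m + 3) × Fin (m + 3)) ℂ) :=
    reindex e e B with hA
  have hAdet : A.det = F := by rw [hA, det_reindex_self, hBdet]
  have hAaff : ∀ i j, (A i j).totalDegree ≤ 1 := fun i j => hBaff _ _
  -- translate to the Mignon–Ressayre point and bound the rank of the Hessian from above
  set A' : Matrix (Fin (w + 1)) (Fin (w + 1)) (MvPolynomial (Fin (m + 3) × Fin (m + 3)) ℂ) :=
    (transl x₀).mapMatrix A with hA'
  have hA'aff : ∀ i j, (A' i j).totalDegree ≤ 1 := fun i j =>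
    (totalDegree_transl_le _ _).trans (hAaff i j)
  have hA'det : A'.det = transl x₀ per * transl x₀ q := by
    rw [hA', ← AlgHom.map_det, hAdet, hFq, map_mul]
  have hper_x₀ : constantCoeff (transl x₀ per) = 0 := by
    rw [constantCoeff_transl, hper_def, hx₀, eval_mrPoint_perPoly]
  have h0 : constantCoeff A'.det = 0 := by
    rw [hA'det, map_mul, hper_x₀, zero_mul]
  have hup : (hess0 A'.det).rank ≤ 2 * (w + 1) := rank_hess0_det_le A' hA'aff h0
  -- … and from below: `H = q(x₀) · H_per(x₀) + (rank ≤ 2)`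
  have hq_x₀ : constantCoeff (transl x₀ q) = P.eval z₀ := by
    rw [constantCoeff_transl, hqx]
  have hH : hess0 A'.det = (P.eval z₀ * (m.factorial : ℂ)) • mrHess ℂ m +
      (vecMulVec (linPart (transl x₀ per)) (linPart (transl x₀ q)) +
        vecMulVec (linPart (transl x₀ q)) (linPart (transl x₀ per))) := by
    rw [hA'det, hess0_mul, hper_x₀, zero_smul, zero_add, hq_x₀, hx₀,
      hess0_transl_mrPoint_perPoly, smul_smul]
  have hlow : (m + 3) ^ 2 ≤ (hess0 A'.det).rank + 2 := by
    have hc : P.eval z₀ * (m.factorial : ℂ) ≠ 0 :=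
      mul_ne_zero hPz (by exact_mod_cast Nat.factorial_ne_zero m)
    have h1 := rank_ge_of_add_vecMulVec ((P.eval z₀ * (m.factorial : ℂ)) • mrHess ℂ m)
      (linPart (transl x₀ per)) (linPart (transl x₀ q))
    rw [rank_smul_eq hc, rank_mrHess, ← hH] at h1
    exact h1
  omega

end Floor


/-- **Stub `stub_krylovMRFloor` (S2½) of line `linear-homogenisation-transfer` — the
Mignon–Ressayre floor INSIDE the Krylov model.**  Every Krylov normal form of `per_n` (`n ≥ 3`)
of width `w` — homogeneous linear `ρ, γ, L` with (A3) `ρᵀL^(n−2)γ = per_n`, (A2) `ρᵀLʲγ = 0`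
(`j < n − 2`), (A4) `per_n ∣ ρᵀLʲγ` (all `j`) — satisfies `n² ≤ 2w + 4`, i.e. the Krylov-constrained
single-matrix power width of the permanent is `≥ n²/2 − 2`, within an additive `1` of what
Mignon–Ressayre give for `dc(per_n) − 1`.  So the quadratic floor transfers to the width model
WITHOUT loss (the transfer `dc ≤ (n−1)·w + 1` by unrolling would only give `w ≳ n/2`), and the
determinantal sub-class (`q_z = z^(w−n+1)`) is not where the floor comes from: it holds for every
transfer numerator `per_n · q_z`.  New (not in Chatterjee–Kumar–Volk 2024, who ask how to use the
Krylov structure; not in the line's cards, which record `w ≥ n` as the model's frontier). -/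
theorem _root_.Summit.ValiantsHypothesis.ValiantsHypothesis.Theorems.DetQPDetqpSuperquadratic.stub_krylovMRFloor :
    ∀ (n w : ℕ) (ρ γ : Fin w → MvPolynomial (Fin n × Fin n) ℂ)
      (L : Matrix (Fin w) (Fin w) (MvPolynomial (Fin n × Fin n) ℂ)),
      3 ≤ n → (∀ i, (ρ i).IsHomogeneous 1) → (∀ i, (γ i).IsHomogeneous 1) →
      (∀ i j, (L i j).IsHomogeneous 1) →
      ρ ⬝ᵥ ((L ^ (n - 2)) *ᵥ γ) = perPoly (Fin n) ℂ →
      (∀ j : ℕ, j < n - 2 → ρ ⬝ᵥ ((L ^ j) *ᵥ γ) = 0) →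
      (∀ j : ℕ, perPoly (Fin n) ℂ ∣ ρ ⬝ᵥ ((L ^ j) *ᵥ γ)) →
      n ^ 2 ≤ 2 * w + 4 := by
  intro n w ρ γ L hn hρ hγ hL hA3 hA2 hA4
  obtain ⟨m, rfl⟩ : ∃ m, n = m + 3 := ⟨n - 3, by omega⟩
  rw [show m + 3 - 2 = m + 1 from rfl] at hA3 hA2
  have h := krylov_floor_core ρ γ L (fun i => (hρ i).totalDegree_le) (fun i => (hγ i).totalDegree_le)
    hL hA3 hA2 hA4
  omega

end KrylovFloor

end Summit.ValiantsHypothesis.ValiantsHypothesis.Theorems.DetQPDetqpSuperquadratic
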